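import Literature.AlgebraicGeometry.Motives.IntegralModelSheetStructureStage        -- ★ (GS-3a) `exists_stage_sheetStructure_thickening`
import Literature.AlgebraicGeometry.AbelianSchemes.PELTupleStageLocalise            -- ★ (GS-2-core) `whiskerLeft_left_comp_whiskerLeft_left_eq_leg`, `genericIso'_inv_left_comp_fst`, `eventually_…`
import Literature.AlgebraicGeometry.Limits.WhiskerLeftMonoHomPointInjective         -- ★ (G3) `mono_specOver_hom_of_isLocalization`
import Literature.AlgebraicGeometry.Motives.GaloisThickening                        -- ★ `thickeningLift`, `thickeningLift_embOfPoint_map_thickeningπ`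
import Mathlib.AlgebraicGeometry.Morphisms.Separated
import Mathlib.AlgebraicGeometry.Morphisms.FinitePresentation
import Mathlib.AlgebraicGeometry.Noetherian
import HarnessLib

/-!
# Stage bookkeeping for the `stub_INJ0` zip: refining the `𝓞 Fᵢ`-sheet structure to a dominating stage, its finiteness properties,
# generic points of a stage through the sheets, and the generic inclusion through a localisation leg

Topic `AlgebraicGeometry/Motives`; namespace `Literature.AlgebraicGeometry.Motives.IntegralModel`.
THEOREMS ONLY (no definition, no instance, no notation, no named fact, no `sorry`).  Cell `hodgecm-mathlib` (D-0151), P6 «MOD programme» (crux hLiu418 =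
stmt-HodgeConjecture-24832, `--supports`, count-neutral); P-LINE ED. 2 closer leaf `Lines/F0_P6a_PELSpread.lean`, socket `stub_INJ0` (LA4-plan DEAL v3: LA4-p03
assembly owner; census `CENSUS-stubINJ0-globalfamily.v2` §1 of A-p14 (g35)).  HC_CM is proved only modulo the printed citations until rung 0 closes; nothing
here is about HC.

THE MATHEMATICS ([EGAIV3] Thm. 8.8.2 (i), (8.8.2.5); [GortzWedhorn2020] §(4.8), (10.7), Cor. 10.64; [SerreTate1968] §1).  `𝒳` a global integral model over
`𝓞 F` of the Galois thickening `X ⊗_F Fᵢ` regarded over `F`; `D(t) = Spec 𝓞_F[1∕t]` the stages (★ `LocalizationDiagram`).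
* §1 `exists_sheetStructure_of_le` — for every stage `t` there is a finer stage `t″ → t` carrying an `𝓞 Fᵢ`-structure `h : 𝒳 ⊗ D(t″) → Spec 𝓞 Fᵢ ⊗ D(t″)`
  over `D(t″)` with the ★ (GS-3a) generic value (refine ★ `exists_stage_sheetStructure_thickening` along ★ `exists_hom₂`; the generic value is kept because
  the cone legs are compatible, ★ `leg_comp_map`).
* §2 `quasiCompact_sheet_fst`, `locallyOfFiniteType_sheet_fst`, `isSeparated_sheet_fst`, `isNoetherian_tensor_stage_left` — `q := h ≫ pr₁ : 𝒳 ⊗ D(t) → Spec 𝓞 Fᵢ`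
  is quasi-compact, locally of finite type and separated when `𝒳 → Spec 𝓞 F` is (cancellation against the affine `Spec 𝓞 Fᵢ → Spec 𝓞 F`), and the stage
  is a Noetherian scheme.
* §3 `exists_thickeningLift_eq_of_comp_sheet_fst_eq` — a point `u : Spec Ω → 𝒳 ⊗ D(t)` whose `q`-value is `Spec (e|𝓞Fᵢ)` for an `F`-embedding `e : Fᵢ → Ω`
  IS a generic point on the sheet `e`: `u = ℓ_e y ≫ 𝒳.genericIso⁻¹ ≫ (𝒳 ◁ leg_t)` for a unique-up-to-nothing `y ∈ X(Ω)` (the generic fibre of the stage is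
  `X ⊗_F Fᵢ`, whose `Ω`-points are pairs ★ `thickeningLift_embOfPoint_map_thickeningπ`; the sheet is pinned by `IsFractionRing` extensionality).
* §4 `genericIso'_inv_left_comp_fst_comp_whiskerLeft_left` — the P-line's generic inclusion `genIncl` followed by the localisation leg `𝒳 ◁ τ` is the
  stage's generic inclusion `𝒳.genericIso⁻¹ ≫ (𝒳 ◁ leg_t)` (★ GS-2-core); `finite_setOf_isEmpty_hom_stage` — all but finitely many `w` reach `D(t)`.

## References
* [EGAIV3] A. Grothendieck, J. Dieudonné, *ÉGA* IV₃, Publ. Math. IHÉS 28 (1966), Thm. 8.8.2 (i) and (8.8.2.5) (p. 28).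
* [GortzWedhorn2020] U. Görtz, T. Wedhorn, *Algebraic Geometry I*, 2nd ed. (2020), §(4.8)–(4.9), Section (10.7), Cor. 10.64 (p. 329).
* [SerreTate1968] J.-P. Serre, J. Tate, *Good reduction of abelian varieties*, Ann. of Math. 88 (1968), §1.
-/

set_option autoImplicit false

noncomputable section

-- Mathlib's `Over`/pull-back API is stated across semireducible wrappers (as in the ★ `Limits/*` and `Motives/IntegralModel*` files).
set_option backward.isDefEq.respectTransparency false

open CategoryTheory CategoryTheory.Limits AlgebraicGeometry MonoidalCategory CartesianMonoidalCategory IsDedekindDomain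
open scoped NumberField
open Literature.AlgebraicGeometry.Limits.LocApprox (Idx baseDiagram leg leg_comp_map exists_hom₂ hom_eq_of_mono_hom mono_specOver_hom_of_isLocalization)
open Literature.AlgebraicGeometry.AbelianSchemes (whiskerLeft_left_comp_whiskerLeft_left_eq_leg eventually_nonempty_hom_specOver_valuationSubringAtPrime_baseDiagram)
open Literature.NumberTheory.EllipticCurves (specGenericPoint)

namespace Literature.AlgebraicGeometry.Motives

namespace IntegralModel

variable {F : Type} [Field F]

/-! ### §1 Refining the `𝓞 Fᵢ`-sheet structure to a stage dominating a given one -/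

section Sheet

variable [NumberField F] {Fi : Type} [Field Fi] [NumberField Fi] [Algebra F Fi]

/-- **For every stage `t` there is a finer stage `t″ → t` with an `𝓞 Fᵢ`-structure `h : 𝒳 ⊗ D(t″) → Spec 𝓞 Fᵢ ⊗ D(t″)` over `D(t″)` having the ★ (GS-3a)
generic value** `(𝒳 ◁ leg_{t″}) ≫ h ≫ pr₁ = 𝒳.genericIso ≫ pr₂ ≫ (Spec Fᵢ → Spec 𝓞 Fᵢ)`. [cite: EGAIV3, Thm. 8.8.2 (i) (p. 28)] [cite: SerreTate1968, §1] -/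
theorem exists_sheetStructure_of_le (X : SchemeOver F) (𝒳 : IntegralModel (𝓞 F) F ((thickening F Fi).obj X))
    [QuasiCompact 𝒳.total.hom] [QuasiSeparated 𝒳.total.hom] (t : Idx (nonZeroDivisors (𝓞 F))) :
    ∃ (t'' : Idx (nonZeroDivisors (𝓞 F))) (_ : t'' ⟶ t)
      (h : 𝒳.total ⊗ (baseDiagram (nonZeroDivisors (𝓞 F))).obj t'' ⟶ specOver (𝓞 F) (𝓞 Fi) ⊗ (baseDiagram (nonZeroDivisors (𝓞 F))).obj t''),
      h ≫ snd _ _ = snd _ _ ∧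
      (𝒳.total ◁ leg (nonZeroDivisors (𝓞 F)) F t'').left ≫ h.left ≫
          pullback.fst (specOver (𝓞 F) (𝓞 Fi)).hom ((baseDiagram (nonZeroDivisors (𝓞 F))).obj t'').hom =
        𝒳.genericIso.hom.left ≫ pullback.snd X.hom (AbelianVariety.bcSpec F Fi) ≫
          Spec.map (CommRingCat.ofHom (algebraMap (𝓞 Fi) Fi)) := by
  obtain ⟨t', h', -, hc'⟩ := exists_stage_sheetStructure_thickening X 𝒳
  obtain ⟨t'', ⟨ρ₁⟩, ⟨ρ₂⟩⟩ := exists_hom₂ (S := nonZeroDivisors (𝓞 F)) t t'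
  refine ⟨t'', ρ₁, lift ((𝒳.total ◁ (baseDiagram (nonZeroDivisors (𝓞 F))).map ρ₂) ≫ h' ≫ fst _ _) (snd _ _), lift_snd _ _, ?_⟩
  have e1 : (lift ((𝒳.total ◁ (baseDiagram (nonZeroDivisors (𝓞 F))).map ρ₂) ≫ h' ≫ fst _ _) (snd _ _)).left ≫
      pullback.fst (specOver (𝓞 F) (𝓞 Fi)).hom ((baseDiagram (nonZeroDivisors (𝓞 F))).obj t'').hom =
      (𝒳.total ◁ (baseDiagram (nonZeroDivisors (𝓞 F))).map ρ₂).left ≫ h'.left ≫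
        pullback.fst (specOver (𝓞 F) (𝓞 Fi)).hom ((baseDiagram (nonZeroDivisors (𝓞 F))).obj t').hom := by
    have := congrArg CommaMorphism.left
      (lift_fst ((𝒳.total ◁ (baseDiagram (nonZeroDivisors (𝓞 F))).map ρ₂) ≫ h' ≫ fst _ _) (snd _ _))
    simpa only [Over.comp_left, Over.fst_left, Category.assoc] using this
  have e2 : (𝒳.total ◁ leg (nonZeroDivisors (𝓞 F)) F t'').left ≫ (𝒳.total ◁ (baseDiagram (nonZeroDivisors (𝓞 F))).map ρ₂).left =
      (𝒳.total ◁ leg (nonZeroDivisors (𝓞 F)) F t').left := by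
    rw [← Over.comp_left, ← MonoidalCategory.whiskerLeft_comp, leg_comp_map]
  rw [e1, ← Category.assoc, e2, hc']

end Sheet

/-! ### §2 Finiteness properties of `q := h ≫ pr₁` and of the stage -/

section Finiteness

variable {Fi : Type} [Field Fi] [Algebra F Fi] (𝒴 : SchemeOver (𝓞 F)) (t : Idx (nonZeroDivisors (𝓞 F)))
  (h : 𝒴 ⊗ (baseDiagram (nonZeroDivisors (𝓞 F))).obj t ⟶ specOver (𝓞 F) (𝓞 Fi) ⊗ (baseDiagram (nonZeroDivisors (𝓞 F))).obj t)

/-- `(h ≫ pr₁) ≫ (Spec 𝓞 Fᵢ → Spec 𝓞 F)` is the structure map of the stage `𝒴 ⊗ D(t)`. [cite: GortzWedhorn2020, §(4.8)] -/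
theorem sheet_fst_comp_specMap :
    (h.left ≫ pullback.fst (specOver (𝓞 F) (𝓞 Fi)).hom ((baseDiagram (nonZeroDivisors (𝓞 F))).obj t).hom) ≫
        Spec.map (CommRingCat.ofHom (algebraMap (𝓞 F) (𝓞 Fi))) =
      (𝒴 ⊗ (baseDiagram (nonZeroDivisors (𝓞 F))).obj t).hom := by
  rw [Category.assoc]
  exact Over.w h

/-- `q := h ≫ pr₁ : 𝒴 ⊗ D(t) → Spec 𝓞 Fᵢ` is quasi-compact when `𝒴 → Spec 𝓞 F` is. [cite: GortzWedhorn2020, Section (10.7)] -/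
theorem quasiCompact_sheet_fst [QuasiCompact 𝒴.hom] :
    QuasiCompact (h.left ≫ pullback.fst (specOver (𝓞 F) (𝓞 Fi)).hom ((baseDiagram (nonZeroDivisors (𝓞 F))).obj t).hom) := by
  haveI : QuasiCompact ((h.left ≫ pullback.fst (specOver (𝓞 F) (𝓞 Fi)).hom ((baseDiagram (nonZeroDivisors (𝓞 F))).obj t).hom) ≫
      Spec.map (CommRingCat.ofHom (algebraMap (𝓞 F) (𝓞 Fi)))) := by
    rw [sheet_fst_comp_specMap, Over.tensorObj_hom]
    infer_instance
  exact QuasiCompact.of_comp _ (Spec.map (CommRingCat.ofHom (algebraMap (𝓞 F) (𝓞 Fi))))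

/-- `q := h ≫ pr₁` is locally of finite type when `𝒴 → Spec 𝓞 F` is. [cite: GortzWedhorn2020, Section (10.7)] -/
theorem locallyOfFiniteType_sheet_fst [LocallyOfFiniteType 𝒴.hom] :
    LocallyOfFiniteType (h.left ≫ pullback.fst (specOver (𝓞 F) (𝓞 Fi)).hom ((baseDiagram (nonZeroDivisors (𝓞 F))).obj t).hom) := by
  haveI : LocallyOfFiniteType ((h.left ≫ pullback.fst (specOver (𝓞 F) (𝓞 Fi)).hom ((baseDiagram (nonZeroDivisors (𝓞 F))).obj t).hom) ≫
      Spec.map (CommRingCat.ofHom (algebraMap (𝓞 F) (𝓞 Fi)))) := by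
    rw [sheet_fst_comp_specMap, Over.tensorObj_hom]
    infer_instance
  exact locallyOfFiniteType_of_comp _ (Spec.map (CommRingCat.ofHom (algebraMap (𝓞 F) (𝓞 Fi))))

/-- `q := h ≫ pr₁` is separated when `𝒴 → Spec 𝓞 F` is. [cite: GortzWedhorn2020, Section (10.7)] -/
theorem isSeparated_sheet_fst [IsSeparated 𝒴.hom] :
    IsSeparated (h.left ≫ pullback.fst (specOver (𝓞 F) (𝓞 Fi)).hom ((baseDiagram (nonZeroDivisors (𝓞 F))).obj t).hom) := by
  haveI : IsSeparated ((h.left ≫ pullback.fst (specOver (𝓞 F) (𝓞 Fi)).hom ((baseDiagram (nonZeroDivisors (𝓞 F))).obj t).hom) ≫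
      Spec.map (CommRingCat.ofHom (algebraMap (𝓞 F) (𝓞 Fi)))) := by
    rw [sheet_fst_comp_specMap, Over.tensorObj_hom]
    infer_instance
  exact IsSeparated.of_comp
    (f := h.left ≫ pullback.fst (specOver (𝓞 F) (𝓞 Fi)).hom ((baseDiagram (nonZeroDivisors (𝓞 F))).obj t).hom)
    (g := Spec.map (CommRingCat.ofHom (algebraMap (𝓞 F) (𝓞 Fi))))

/-- The stage `𝒴 ⊗ D(t)` is a Noetherian scheme when `𝒴 → Spec 𝓞 F` is quasi-compact and locally of finite type. [cite: GortzWedhorn2020, Section (10.7)] -/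
theorem isNoetherian_tensor_stage_left [NumberField F] [QuasiCompact 𝒴.hom] [LocallyOfFiniteType 𝒴.hom] :
    IsNoetherian (𝒴 ⊗ (baseDiagram (nonZeroDivisors (𝓞 F))).obj t).left := by
  haveI : LocallyOfFiniteType (𝒴 ⊗ (baseDiagram (nonZeroDivisors (𝓞 F))).obj t).hom := by
    rw [Over.tensorObj_hom]; infer_instance
  haveI : QuasiCompact (𝒴 ⊗ (baseDiagram (nonZeroDivisors (𝓞 F))).obj t).hom := by
    rw [Over.tensorObj_hom]; infer_instance
  haveI : IsLocallyNoetherian (𝒴 ⊗ (baseDiagram (nonZeroDivisors (𝓞 F))).obj t).left :=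
    LocallyOfFiniteType.isLocallyNoetherian (𝒴 ⊗ (baseDiagram (nonZeroDivisors (𝓞 F))).obj t).hom
  haveI : CompactSpace ↥(𝒴 ⊗ (baseDiagram (nonZeroDivisors (𝓞 F))).obj t).left :=
    QuasiCompact.compactSpace_of_compactSpace (𝒴 ⊗ (baseDiagram (nonZeroDivisors (𝓞 F))).obj t).hom
  exact {}

end Finiteness

/-! ### §3 Generic points of a stage lie on the sheets -/

section Points

variable [NumberField F] {Fi : Type} [Field Fi] [NumberField Fi] [Algebra F Fi]

/-- **A point of the stage whose `q`-value is `Spec (e|𝓞Fᵢ)` is a generic point on the sheet `e`.**  For `h` with the ★ (GS-3a) generic value and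
`u : Spec Ω → 𝒳 ⊗ D(t)` with `u ≫ h ≫ pr₁ = Spec (𝓞 Fᵢ → Fᵢ →ᵉ Ω)`: `u = ℓ_e y ≫ 𝒳.genericIso⁻¹ ≫ (𝒳 ◁ leg_t)` for some `y ∈ X(Ω)` (`u` lies over the generic
point of `Spec 𝓞 F`, so it factors through the generic fibre `𝒳 ⊗ Spec F ≅ X ⊗_F Fᵢ` — second components into the monomorphism `D(t) → Spec 𝓞 F` agree —
whose `Ω`-points are the pairs `ℓ_{e′} y`, ★ `thickeningLift_embOfPoint_map_thickeningπ`; `e′ = e` since both restrict to the same map on `𝓞 Fᵢ`).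
[cite: GortzWedhorn2020, §(4.8)–(4.9) and Cor. 10.64 (2) (p. 329)] [cite: EGAIV3, Thm. 8.8.2 (i) (p. 28)] -/
theorem exists_thickeningLift_eq_of_comp_sheet_fst_eq (X : SchemeOver F) (𝒳 : IntegralModel (𝓞 F) F ((thickening F Fi).obj X))
    (t : Idx (nonZeroDivisors (𝓞 F)))
    (h : 𝒳.total ⊗ (baseDiagram (nonZeroDivisors (𝓞 F))).obj t ⟶ specOver (𝓞 F) (𝓞 Fi) ⊗ (baseDiagram (nonZeroDivisors (𝓞 F))).obj t)
    (hgen : (𝒳.total ◁ leg (nonZeroDivisors (𝓞 F)) F t).left ≫ h.left ≫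
          pullback.fst (specOver (𝓞 F) (𝓞 Fi)).hom ((baseDiagram (nonZeroDivisors (𝓞 F))).obj t).hom =
        𝒳.genericIso.hom.left ≫ pullback.snd X.hom (AbelianVariety.bcSpec F Fi) ≫
          Spec.map (CommRingCat.ofHom (algebraMap (𝓞 Fi) Fi)))
    {Ω : Type} [Field Ω] [Algebra F Ω] (e : Fi →ₐ[F] Ω) (u : Spec (.of Ω) ⟶ (𝒳.total ⊗ (baseDiagram (nonZeroDivisors (𝓞 F))).obj t).left)
    (hu : u ≫ h.left ≫ pullback.fst (specOver (𝓞 F) (𝓞 Fi)).hom ((baseDiagram (nonZeroDivisors (𝓞 F))).obj t).hom =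
      Spec.map (CommRingCat.ofHom ((e : Fi →+* Ω).comp (algebraMap (𝓞 Fi) Fi)))) :
    ∃ y : AlgPoints X Ω, u = (thickeningLift e X y).left ≫ 𝒳.genericIso.inv.left ≫ (𝒳.total ◁ leg (nonZeroDivisors (𝓞 F)) F t).left := by
  -- the structure map of `u` over `Spec 𝓞 F`
  have hring : ((e : Fi →+* Ω).comp (algebraMap (𝓞 Fi) Fi)).comp (algebraMap (𝓞 F) (𝓞 Fi)) =
      (algebraMap F Ω).comp (algebraMap (𝓞 F) F) := by
    ext a
    simp only [RingHom.coe_comp, RingHom.coe_coe, Function.comp_apply]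
    rw [← IsScalarTower.algebraMap_apply (𝓞 F) (𝓞 Fi) Fi, IsScalarTower.algebraMap_apply (𝓞 F) F Fi, AlgHom.commutes]
  have hP : u ≫ (𝒳.total ⊗ (baseDiagram (nonZeroDivisors (𝓞 F))).obj t).hom =
      Spec.map (CommRingCat.ofHom (algebraMap F Ω)) ≫ Spec.map (CommRingCat.ofHom (algebraMap (𝓞 F) F)) := by
    rw [← sheet_fst_comp_specMap 𝒳.total t h, Category.assoc, reassoc_of% hu, ← Spec.map_comp, ← Spec.map_comp, ← CommRingCat.ofHom_comp,
      ← CommRingCat.ofHom_comp, hring]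
  -- the lift to the generic fibre `𝒳 ⊗ Spec F`
  have hP' : (u ≫ pullback.fst 𝒳.total.hom ((baseDiagram (nonZeroDivisors (𝓞 F))).obj t).hom) ≫ 𝒳.total.hom =
      Spec.map (CommRingCat.ofHom (algebraMap F Ω)) ≫ Spec.map (CommRingCat.ofHom (algebraMap (𝓞 F) F)) := by
    rw [Category.assoc, ← Over.tensorObj_hom]; exact hP
  let m : Spec (.of Ω) ⟶ ((Motives.baseChange (𝓞 F) F).obj 𝒳.total).left :=
    pullback.lift (u ≫ pullback.fst 𝒳.total.hom ((baseDiagram (nonZeroDivisors (𝓞 F))).obj t).hom)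
      (Spec.map (CommRingCat.ofHom (algebraMap F Ω))) hP'
  have hm : m ≫ (𝒳.total ◁ leg (nonZeroDivisors (𝓞 F)) F t).left = u := by
    apply pullback.hom_ext
    · rw [Category.assoc, Over.whiskerLeft_left_fst]
      exact pullback.lift_fst _ _ _
    · haveI : Mono ((baseDiagram (nonZeroDivisors (𝓞 F))).obj t).hom :=
        mono_specOver_hom_of_isLocalization (Submonoid.powers t.val) (Localization.Away t.val)
      rw [← cancel_mono ((baseDiagram (nonZeroDivisors (𝓞 F))).obj t).hom]
      have el : (m ≫ (𝒳.total ◁ leg (nonZeroDivisors (𝓞 F)) F t).left) ≫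
          pullback.snd 𝒳.total.hom ((baseDiagram (nonZeroDivisors (𝓞 F))).obj t).hom ≫ ((baseDiagram (nonZeroDivisors (𝓞 F))).obj t).hom =
          Spec.map (CommRingCat.ofHom (algebraMap F Ω)) ≫ Spec.map (CommRingCat.ofHom (algebraMap (𝓞 F) F)) := by
        rw [Category.assoc, ← Category.assoc (𝒳.total ◁ leg (nonZeroDivisors (𝓞 F)) F t).left, Over.whiskerLeft_left_snd, Category.assoc,
          Over.w (leg (nonZeroDivisors (𝓞 F)) F t)]
        change pullback.lift _ _ _ ≫ pullback.snd _ _ ≫ Spec.map (CommRingCat.ofHom (algebraMap (𝓞 F) F)) = _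
        rw [pullback.lift_snd_assoc]
      have er : (u ≫ pullback.snd 𝒳.total.hom ((baseDiagram (nonZeroDivisors (𝓞 F))).obj t).hom) ≫
          ((baseDiagram (nonZeroDivisors (𝓞 F))).obj t).hom =
          Spec.map (CommRingCat.ofHom (algebraMap F Ω)) ≫ Spec.map (CommRingCat.ofHom (algebraMap (𝓞 F) F)) := by
        rw [Category.assoc, ← pullback.condition, ← Category.assoc, hP']
      simp only [Category.assoc] at el er ⊢
      rw [el, er]
  -- the point of the thickening and its sheet
  let ℓ : AlgPoints ((thickening F Fi).obj X) Ω := Over.homMk (m ≫ 𝒳.genericIso.hom.left) (by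
    change (m ≫ 𝒳.genericIso.hom.left) ≫ ((thickening F Fi).obj X).hom = Spec.map (CommRingCat.ofHom (algebraMap F Ω))
    rw [Category.assoc, Over.w 𝒳.genericIso.hom]
    exact pullback.lift_snd _ _ _)
  have hℓu : ℓ.left ≫ 𝒳.genericIso.inv.left ≫ (𝒳.total ◁ leg (nonZeroDivisors (𝓞 F)) F t).left = u := by
    change (m ≫ 𝒳.genericIso.hom.left) ≫ _ = u
    rw [Category.assoc, ← Over.comp_left_assoc, Iso.hom_inv_id, Over.id_left, Category.id_comp, hm]
  -- the sheet of `ℓ` is `e`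
  have hσ : AlgPoints.embOfPoint ((Motives.baseChange F Fi).obj X) ℓ = e := by
    have h1 := specMap_embOfPoint_eq_comp_snd X ℓ
    have h2 : ℓ.left ≫ pullback.snd X.hom (AbelianVariety.bcSpec F Fi) ≫ Spec.map (CommRingCat.ofHom (algebraMap (𝓞 Fi) Fi)) =
        Spec.map (CommRingCat.ofHom ((e : Fi →+* Ω).comp (algebraMap (𝓞 Fi) Fi))) := by
      have hid : 𝒳.genericIso.inv.left ≫ 𝒳.genericIso.hom.left = 𝟙 _ := by rw [← Over.comp_left, Iso.inv_hom_id, Over.id_left]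
      rw [← hu, ← hℓu, Category.assoc, Category.assoc, hgen, ← Category.assoc 𝒳.genericIso.inv.left, hid, Category.id_comp]
    rw [← reassoc_of% h1, ← Spec.map_comp, ← CommRingCat.ofHom_comp] at h2
    have h3 := congrArg (fun f => f.hom) (Spec.map_injective h2)
    simp only [CommRingCat.hom_ofHom] at h3
    have h4 : (AlgPoints.embOfPoint ((Motives.baseChange F Fi).obj X) ℓ).toRingHom = (e : Fi →+* Ω) :=
      IsLocalization.ringHom_ext (nonZeroDivisors (𝓞 Fi)) h3
    exact AlgHom.coe_ringHom_injective h4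
  refine ⟨AlgPoints.map (thickeningπ X) ℓ, ?_⟩
  rw [← hσ, thickeningLift_embOfPoint_map_thickeningπ X ℓ, hℓu]

end Points

/-! ### §4 The generic inclusion through a localisation leg; cofinitely many `w` reach a stage -/

section Leg

variable [NumberField F]

/-- **`genIncl ≫ (𝒳 ◁ τ) = 𝒳.genericIso⁻¹ ≫ (𝒳 ◁ leg_t)`**: the generic inclusion of the localised model (`genericIso′⁻¹ ≫ pr₁`, the P-line's `genIncl`)
followed by the localisation leg `𝒳 ⊗ Spec 𝒪_{F,(w)} → 𝒳 ⊗ D(t)` is the stage's generic inclusion (★ `genericIso'_inv_left_comp_fst` with the tower morphism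
`Spec F → Spec 𝒪_{F,(w)}`, ★ `whiskerLeft_left_comp_whiskerLeft_left_eq_leg`). [cite: SerreTate1968, §1] [cite: GortzWedhorn2020, Prop. 4.16 and §(4.8)] -/
theorem genericIso'_inv_left_comp_fst_comp_whiskerLeft_left {X' : SchemeOver F} (𝒳 : IntegralModel (𝓞 F) F X') (w : HeightOneSpectrum (𝓞 F))
    (t : Idx (nonZeroDivisors (𝓞 F)))
    (τ : specOver (𝓞 F) (HeightOneSpectrum.valuationSubringAtPrime F w) ⟶ (baseDiagram (nonZeroDivisors (𝓞 F))).obj t) :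
    ((𝒳.localise w).genericIso'.inv.left ≫ pullback.fst (𝒳.localise w).total.hom
        (specGenericPoint (HeightOneSpectrum.valuationSubringAtPrime F w) F)) ≫ (𝒳.total ◁ τ).left =
      𝒳.genericIso.inv.left ≫ (𝒳.total ◁ leg (nonZeroDivisors (𝓞 F)) F t).left := by
  let κ : specOver (𝓞 F) F ⟶ specOver (𝓞 F) (HeightOneSpectrum.valuationSubringAtPrime F w) :=
    Over.homMk (Spec.map (CommRingCat.ofHom (algebraMap (HeightOneSpectrum.valuationSubringAtPrime F w) F))) (by
      change Spec.map _ ≫ Spec.map _ = Spec.map _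
      rw [← Spec.map_comp, ← CommRingCat.ofHom_comp, ← IsScalarTower.algebraMap_eq])
  have h1 := genericIso'_inv_left_comp_fst 𝒳 w κ rfl
  change ((𝒳.localise w).genericIso'.inv.left ≫ pullback.fst (𝒳.localise w).total.hom
    (Spec.map (CommRingCat.ofHom (algebraMap (HeightOneSpectrum.valuationSubringAtPrime F w) F)))) ≫ _ = _
  rw [h1, Category.assoc, whiskerLeft_left_comp_whiskerLeft_left_eq_leg (nonZeroDivisors (𝓞 F)) F 𝒳.total t
    (HeightOneSpectrum.valuationSubringAtPrime F w) τ κ]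

/-- **All but finitely many `w` reach the stage `D(t)`**: the set of `w` with NO `𝓞 F`-morphism `Spec 𝒪_{F,(w)} → D(t)` is finite
(★ `eventually_nonempty_hom_specOver_valuationSubringAtPrime_baseDiagram`). [cite: EGAIV3, Thm. 8.8.2 and (8.8.2.5)] [cite: SerreTate1968, §1] -/
theorem finite_setOf_isEmpty_hom_stage (t : Idx (nonZeroDivisors (𝓞 F))) :
    {w : HeightOneSpectrum (𝓞 F) |
      IsEmpty (specOver (𝓞 F) (HeightOneSpectrum.valuationSubringAtPrime F w) ⟶ (baseDiagram (nonZeroDivisors (𝓞 F))).obj t)}.Finite := by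
  have h := eventually_nonempty_hom_specOver_valuationSubringAtPrime_baseDiagram (F := F) t
  rw [Filter.eventually_cofinite] at h
  exact h.subset fun w hw => by simpa only [Set.mem_setOf_eq, not_nonempty_iff] using hw

end Leg

end IntegralModel

end Literature.AlgebraicGeometry.Motives

end
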